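import Summits.QuantumFields.BalabanUV.T4Continuum.Support.NE7ConstrainedPoincarePureGauge
import Summits.QuantumFields.BalabanUV.T4Continuum.Support.NE7ConstrainedPoincareLift
import Summits.QuantumFields.BalabanUV.T4Continuum.Support.NE7ConstrainedGreenRowsSplit
import Summits.QuantumFields.BalabanUV.T4Continuum.Support.NE7OneStepLetters
import Summits.QuantumFields.BalabanUV.T4Continuum.Support.NE3CurlOfGaugeDir
import Summits.QuantumFields.BalabanUV.T4Continuum.Support.NE3CovariantCompetitorValue

/-!
# NE7ConstrainedPoincareAssembly — THE CONSTRAINED POINCARÉ INEQUALITY (CP_W) OF F212 ASSEMBLED BY THE TRIANGLE INEQUALITY FROM ITS THREE PIECES: (CP_W) on ALL skew torus 1-forms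
# follows from [slice Poincaré on `T_A = ker Q̄_W ∩ ker R D_W†` (constant `C_T`)] + [the Landau correction inside `N(Q′(W))`] + [`‖R D_W† v‖² ≤ κ·dirSq v`], the gauge piece (F213),
# the lift piece (F214), the gauge-curl smallness `curlSq_W(D_Wμ) ≤ 16·n·#Plane·η²M²·dirSq(D_Wμ)` (row NE3's `curlSq_gaugeDir_le` + gauge Poincaré, PROVED here) and the crude
# `curlSq ≤ 16d·dirSq` — with explicit constants `C₁ = 9·C_T·n + 8nM²(9C_Tε_g + 3)`, `C₂ = (8nM²κ(9C_Tε_g + 3) + 144d·C_T + 3)·C_L` (file 144 of the curved (APE), F215)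

Cell `pub-balaban`, rung (B)+1 sub-cell t4, lineage `b2b-balaban-t4-ne7-p1` (CRUX PROVER NE7 #1 = OWNER of row NE7), generation 85; memo
`t4/b2b-balaban-t4-ne7-p1-g85/LAGRANGE-CARRIER.md` §13.
WHY.  F212 proved (P_a) ⟸ (CP_W); F213 and F214 proved (CP_W) on pure gauges and on lifts.  Because (CP_W) is a NORM inequality, the general skew form `b` is handled by writing
`b = t + D_Wμ + r` — `r` the lift of `Q̄_W b` (F214), `μ ∈ N(Q′(W))` the Landau correction of `b − r ∈ ker Q̄_W`, `t` the remainder in the slice `T_A` — and adding the three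
pieces with the parallelogram bound; the curl of `t` is recovered from the curls of `b`, `D_Wμ` (curvature-small: `curlSq_gaugeDir_le` of row NE3 and the gauge Poincaré of
`NE3CornerGaugePoincare`) and `r` (crude lattice bound `NE7OneStepLetters.curlSq_le_dirSq`), and `R D_W†(D_Wμ) = R D_W† b − R D_W† r` since `t` is Landau.  THIS file is that
bookkeeping, so that (CP_W) — hence (P_a), hence the first hypothesis of the END F204 — rests on exactly THREE row-NE3-type letters, taken as hypotheses here:
(H1) slice Poincaré on `T_A` «`Q̄ t = 0`, `R D† t = 0` ⟹ `dirSq(Ft) ≤ C_T·curlSq_W(Ft)`» (row NE3 proves it on its slice `frameFreeBlockLandauW`, `classSlicePoincare_of_lines`; the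
re-parametrisation to `T_A` is the successor's), (H2) the Landau correction «`Q̄ b′ = 0` ⟹ `∃ μ ∈ N(Q′(W))`, `R D†(b′ − D_Wμ) = 0`, `Q̄ D_Wμ = 0`» (row NE3's `NE3.LandauProjectionB8` ∕
lineage #2's `dirIter_testLift_eq_zero` are the sources), (H4) «`‖R D† v‖² ≤ κ·dirSq(Fv)`» (boundedness of the lattice covariant divergence; `R` is a projection).
WHAT ([folklore]; 0 def, 0 sorry).  §1 `norm_sub3_sq_le` (with row NE3's `NE3CovariantCompetitorValue.normSq_add₃_le`), `dirSq_le_of_eq_add3`, `curlSq_le_of_eq_sub3`, `inner_self_le_of_eq_sub` (parallelogram bounds), `landauDiv_sub`; §2 **`curlSq_pureGauge_le`** (gauge-curl smallness,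
`ε_g = 16·n·#Plane·η²·M²`); §3 `core_assembly` (the real-number bookkeeping) and **`constrainedPoincare_of_pieces`** ((CP_W) for every skew `b` from (H1), (H2), (H4), in F212's shape).
HONEST FRAMING (page 1): (H1), (H2), (H4) are HYPOTHESES — (CP_W) and (P_a) are NOT proved unconditionally; (KL-B) at curved `W` NOT proved; (APE) on curved data NOT proved; NOT ONE-STEP,
NOT NE7; spine 0∕9; finite T⁴ rung (B)+1 — NOT infinite volume, NOT mass gap, NOT `BetaPertH`, NOT Clay.  Continuum YM on T⁴ ⇐ BetaPertH ∧ nine spine estimates (0/9 proved);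
BetaPertH ⇐ (D1) ∧ (D4) ∧ CAP+tail; G-an2-4 gates asym, D1 and NE2/3/4.
-/

set_option autoImplicit false

open scoped BigOperators InnerProductSpace Matrix Matrix.Norms.L2Operator
open Finset

namespace Summit.QuantumFields.BalabanUV.T4Continuum.NE7ConstrainedPoincareAssembly

open Literature.MathematicalPhysics.QuantumFieldTheory.Balaban1983to89
open B7Prop1Explicit B7Prop2Explicit UnitaryModel MatrixNorms
open T4AveragingDeficitWall (IsUnitaryCfg IsSkewDir SmallField dirSq curlSq curl curlAt)
open T4AveragingDeficitWallBoundary (periodBox IsPeriodicCfg)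
open AveragingDeficitPeriodicCounting (IsPeriodicDir)
open AveragingDeficitMultiLevelPrep (LevelSmall)
open AveragingDeficitTwoLevelPrep (prop1Radius)
open SpreadLift (loopRad)
open BlockAveragePushDirGauge (gaugeDir isPeriodicDir_gaugeDir)
open NE3HilbertSchmidtTorus
open NE3.PairLandauB8 (avgKernelGauges mem_avgKernelGauges_iff)
open NE3EnergyHessContTwoTerm (curlSq_nonneg dirSq_nonneg)
open NE3QbarIterCovLiftPrep (cruxC liftC)
open NE3RightInverseSolveLetters (thetaLoc)
open NE3CurlOfGaugeDir (curlSq_gaugeDir_le)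
open NE3CovariantCompetitorValue (normSq_add₃_le)
open NE3CornerGaugePoincare (sum_nhsNormSq_le_four_mul_of_bmeanIterW_eq_zero)
open NE7BalabanSoftOperator
open NE7GaugeFixOnPureGauges (resS_mem_of_avgKernel coe_gradOpK_resS)
open NE7ConstrainedGreenRowsSplit (extF_coe_sub curlAt_extF_coe_sub)
open NE7OneStepLetters (curlSq_le_dirSq)
open NE7ConstrainedPoincarePureGauge (constrainedPoincare_pureGauge)
open NE7ConstrainedPoincareLift (exists_lift_dirSq_le)

noncomputable section

variable {d : ℕ} {n : Type*} [Fintype n] [DecidableEq n]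

/-! ## §1 Parallelogram bounds on the carrier -/

/-- `‖u − v − w‖² ≤ 3(‖u‖² + ‖v‖² + ‖w‖²)`. [folklore] -/
theorem norm_sub3_sq_le {E : Type*} [SeminormedAddCommGroup E] (u v w : E) :
    ‖u - v - w‖ ^ 2 ≤ 3 * ‖u‖ ^ 2 + 3 * ‖v‖ ^ 2 + 3 * ‖w‖ ^ 2 := by
  have h := normSq_add₃_le u (-v) (-w)
  rw [norm_neg, norm_neg, ← sub_eq_add_neg, ← sub_eq_add_neg] at h
  exact h

/-- **PARALLELOGRAM BOUND FOR `dirSq`**: if `s = a + b + c` (skew torus 1-forms), `dirSq (extF s) ≤ 3·dirSq (extF a) + 3·dirSq (extF b) + 3·dirSq (extF c)`. [folklore] -/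
theorem dirSq_le_of_eq_add3 {P : ℕ} [NeZero P] (a b c s : skewForms d n P) (hs : s = a + b + c) (F : Finset (Site d)) :
    dirSq (extF P (s : Form d n P)) F
      ≤ 3 * dirSq (extF P (a : Form d n P)) F + 3 * dirSq (extF P (b : Form d n P)) F + 3 * dirSq (extF P (c : Form d n P)) F := by
  subst hs
  unfold dirSq
  rw [Finset.mul_sum, Finset.mul_sum, Finset.mul_sum, ← Finset.sum_add_distrib, ← Finset.sum_add_distrib]
  refine Finset.sum_le_sum fun y _ => ?_
  rw [Finset.mul_sum, Finset.mul_sum, Finset.mul_sum, ← Finset.sum_add_distrib, ← Finset.sum_add_distrib]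
  refine Finset.sum_le_sum fun κ _ => ?_
  rw [Submodule.coe_add, Submodule.coe_add, extF_add, extF_add]
  exact normSq_add₃_le _ _ _

/-- **PARALLELOGRAM BOUND FOR `curlSq`**: if `s = a − b − c` (skew torus 1-forms), `curlSq W (extF s) ≤ 3·curlSq W (extF a) + 3·curlSq W (extF b) + 3·curlSq W (extF c)`. [folklore] -/
theorem curlSq_le_of_eq_sub3 (W : Site d → Fin d → (Matrix n n ℂ)ˣ) {P : ℕ} [NeZero P] (a b c s : skewForms d n P) (hs : s = a - b - c)
    (F : Finset (Site d)) :
    curlSq W (extF P (s : Form d n P)) F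
      ≤ 3 * curlSq W (extF P (a : Form d n P)) F + 3 * curlSq W (extF P (b : Form d n P)) F + 3 * curlSq W (extF P (c : Form d n P)) F := by
  subst hs
  unfold curlSq
  rw [Finset.mul_sum, Finset.mul_sum, Finset.mul_sum, ← Finset.sum_add_distrib, ← Finset.sum_add_distrib]
  refine Finset.sum_le_sum fun z _ => ?_
  rw [Finset.mul_sum, Finset.mul_sum, Finset.mul_sum, ← Finset.sum_add_distrib, ← Finset.sum_add_distrib]
  refine Finset.sum_le_sum fun π _ => ?_
  show ‖curlAt W (extF P ((a - b - c : skewForms d n P) : Form d n P)) z π.1.1 π.1.2‖ ^ 2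
    ≤ 3 * ‖curlAt W (extF P (a : Form d n P)) z π.1.1 π.1.2‖ ^ 2 + 3 * ‖curlAt W (extF P (b : Form d n P)) z π.1.1 π.1.2‖ ^ 2
      + 3 * ‖curlAt W (extF P (c : Form d n P)) z π.1.1 π.1.2‖ ^ 2
  rw [curlAt_extF_coe_sub, curlAt_extF_coe_sub]
  exact norm_sub3_sq_le _ _ _

/-- `g = p − q ⟹ ⟪g, g⟫ ≤ 2⟪p, p⟫ + 2⟪q, q⟫` in a real inner product space. [folklore] -/
theorem inner_self_le_of_eq_sub {E : Type*} [NormedAddCommGroup E] [InnerProductSpace ℝ E] (g p q : E) (hg : g = p - q) :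
    ⟪g, g⟫_ℝ ≤ 2 * ⟪p, p⟫_ℝ + 2 * ⟪q, q⟫_ℝ := by
  subst hg
  have h0 : 0 ≤ ⟪p + q, p + q⟫_ℝ := real_inner_self_nonneg
  rw [inner_add_left, inner_add_right, inner_add_right, real_inner_comm p q] at h0
  rw [inner_sub_left, inner_sub_right, inner_sub_right, real_inner_comm p q]
  linarith

/-! ## §2 Gauge-curl smallness: the curl energy of a pure gauge from `N(Q′(W))` -/

section Carrier

variable [Nonempty n] {L N : ℕ} [NeZero N] (hL : 1 ≤ L) (hL2 : 2 ≤ L) (j : ℕ) [NeZero (N * L ^ (j + 1))]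
  {W : Site d → Fin d → (Matrix n n ℂ)ˣ} {x : ℝ} (hWu : IsUnitaryCfg W) (hWP : IsPeriodicCfg W ((N * L ^ (j + 1) : ℕ) : ℤ))
  (hx : 0 ≤ x) (hs : LevelSmall d L j x) (hWx : SmallField W x)
  (hθ : cruxC d L * (((L : ℝ) ^ (j + 1)) ^ 2 * x) < 1) (hθl : thetaLoc d L * (((L : ℝ) ^ (j + 1)) ^ 2 * x) < 1) (hd : 1 ≤ d)

omit [NeZero N] in
include hL2 hWP hx hs hWx in
/-- **GAUGE-CURL SMALLNESS**: for `μ ∈ N(Q′(W))`, `g = D_Wμ`, a background of plaquette radius `η` and row NE3's Poincaré regime `hsmall`: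
`curlSq W (extF g) (periodBox P) ≤ 16·n·#Plane·η²·M²·dirSq (extF g) (periodBox P)` — the curl of a pure gauge is curvature × generator (`curlSq_gaugeDir_le`), and the generator is
controlled by its covariant derivative (gauge Poincaré). [folklore] -/
theorem curlSq_pureGauge_le {η : ℝ} (hWη : SmallField W η)
    (hsmall : 8 * d * (((L : ℝ) ^ (j + 1)) * (((d : ℝ) - 1) * (((L : ℝ) ^ (j + 1)) - 1) * x)) ^ 2
      + 2 * (Fintype.card n * (4 * (d : ℝ) ^ 2 * ((L : ℝ) ^ (j + 1) - 1) ^ 2 * x + 16 * d * loopRad d L ((prop1Radius d L)^[j] x)) ^ 2) ≤ 1 / 2)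
    {μ : Site d → Matrix n n ℂ} (hμ : μ ∈ avgKernelGauges (d := d) (n := n) L N (j + 1) W) :
    curlSq W (extF (N * L ^ (j + 1))
        ((gradOpK hWu (N * L ^ (j + 1)) ⟨resS (N * L ^ (j + 1)) μ, resS_mem_of_avgKernel hμ⟩ : skewForms d n (N * L ^ (j + 1))) : Form d n (N * L ^ (j + 1))))
        (periodBox (d := d) (N * L ^ (j + 1)))
      ≤ 16 * Fintype.card n * (Fintype.card (T4AveragingDeficitWall.Plane d)) * η ^ 2 * ((L : ℝ) ^ (j + 1)) ^ 2
        * dirSq (extF (N * L ^ (j + 1))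
            ((gradOpK hWu (N * L ^ (j + 1)) ⟨resS (N * L ^ (j + 1)) μ, resS_mem_of_avgKernel hμ⟩ : skewForms d n (N * L ^ (j + 1))) : Form d n (N * L ^ (j + 1))))
            (periodBox (d := d) (N * L ^ (j + 1))) := by
  obtain ⟨-, hμP, hμ0⟩ := mem_avgKernelGauges_iff.mp hμ
  rw [coe_gradOpK_resS hWu hμ, extF_resF _ (isPeriodicDir_gaugeDir hWP hμP)]
  -- curl of a pure gauge = curvature × generator
  have h1 := curlSq_gaugeDir_le hWu hWη μ (periodBox (d := d) (N * L ^ (j + 1)))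
  -- operator vs normalised Hilbert–Schmidt
  have h2 : ∑ z ∈ periodBox (d := d) (N * L ^ (j + 1)), ‖μ z‖ ^ 2 ≤ Fintype.card n * ∑ z ∈ periodBox (d := d) (N * L ^ (j + 1)), nhsNormSq (μ z) := by
    rw [Finset.mul_sum]
    exact Finset.sum_le_sum fun z _ => opNorm_sq_le_card_mul_nhsNormSq _
  -- gauge Poincaré
  have h3 : ∑ z ∈ periodBox (d := d) (N * L ^ (j + 1)), nhsNormSq (μ z)
      ≤ 4 * (((L : ℝ) ^ (j + 1)) ^ 2 * ∑ z ∈ periodBox (d := d) (N * L ^ (j + 1)), ∑ κ : Fin d, nhsNormSq (gaugeDir W μ z κ)) := by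
    have h := sum_nhsNormSq_le_four_mul_of_bmeanIterW_eq_zero hL2 j hWu hx hs hWx N μ (fun z _ => by rw [hμ0]; rfl) hsmall
    rwa [Nat.mul_comm] at h
  have h4 : ∑ z ∈ periodBox (d := d) (N * L ^ (j + 1)), ∑ κ : Fin d, nhsNormSq (gaugeDir W μ z κ) ≤ dirSq (gaugeDir W μ) (periodBox (d := d) (N * L ^ (j + 1))) := by
    unfold dirSq
    exact Finset.sum_le_sum fun z _ => Finset.sum_le_sum fun κ _ => nhsNormSq_le_opNorm_sq _
  have hP0 : 0 ≤ (4 : ℝ) * η ^ 2 * (Fintype.card (T4AveragingDeficitWall.Plane d)) := by positivity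
  have hn0 : 0 ≤ (Fintype.card n : ℝ) := Nat.cast_nonneg _
  have hM0 : 0 ≤ 4 * ((L : ℝ) ^ (j + 1)) ^ 2 := by positivity
  calc curlSq W (gaugeDir W μ) (periodBox (d := d) (N * L ^ (j + 1)))
      ≤ 4 * η ^ 2 * (Fintype.card (T4AveragingDeficitWall.Plane d)) * ∑ z ∈ periodBox (d := d) (N * L ^ (j + 1)), ‖μ z‖ ^ 2 := h1
    _ ≤ 4 * η ^ 2 * (Fintype.card (T4AveragingDeficitWall.Plane d)) * (Fintype.card n * (4 * (((L : ℝ) ^ (j + 1)) ^ 2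
          * dirSq (gaugeDir W μ) (periodBox (d := d) (N * L ^ (j + 1)))))) := by
        refine mul_le_mul_of_nonneg_left (h2.trans (mul_le_mul_of_nonneg_left (h3.trans ?_) hn0)) hP0
        exact mul_le_mul_of_nonneg_left (mul_le_mul_of_nonneg_left h4 (by positivity)) (by norm_num)
    _ = _ := by ring

omit [Nonempty n] [NeZero N] in
/-- `R D†` is subtractive: `R D†(u − v) = R D† u − R D† v`. [folklore] -/
theorem landauDiv_sub (u v : skewForms d n (N * L ^ (j + 1))) :
    landauProjK L N (j + 1) W
        ((LinearMap.adjoint (𝕜 := ℝ) (E := skewSecs d n (N * L ^ (j + 1))) (F := skewForms d n (N * L ^ (j + 1))) (gradOpK hWu (N * L ^ (j + 1)))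
          : skewForms d n (N * L ^ (j + 1)) →ₗ[ℝ] skewSecs d n (N * L ^ (j + 1))) (u - v))
      = landauProjK L N (j + 1) W
          ((LinearMap.adjoint (𝕜 := ℝ) (E := skewSecs d n (N * L ^ (j + 1))) (F := skewForms d n (N * L ^ (j + 1))) (gradOpK hWu (N * L ^ (j + 1)))
            : skewForms d n (N * L ^ (j + 1)) →ₗ[ℝ] skewSecs d n (N * L ^ (j + 1))) u)
        - landauProjK L N (j + 1) W
          ((LinearMap.adjoint (𝕜 := ℝ) (E := skewSecs d n (N * L ^ (j + 1))) (F := skewForms d n (N * L ^ (j + 1))) (gradOpK hWu (N * L ^ (j + 1)))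
            : skewForms d n (N * L ^ (j + 1)) →ₗ[ℝ] skewSecs d n (N * L ^ (j + 1))) v) := by
  rw [map_sub, map_sub]

/-! ## §3 The assembly -/

/-- The real-number bookkeeping of the assembly. [folklore] -/
theorem core_assembly {Db Dt Dg R cb cg cr ct G Gg Gr Qn CT εg κ CL A dd nn : ℝ}
    (hCT : 0 ≤ CT) (hεg : 0 ≤ εg) (hκ : 0 ≤ κ) (hA : 0 ≤ A) (hdd : 0 ≤ dd) (hnn : 0 < nn) (hcb : 0 ≤ cb) (hG : 0 ≤ G)
    (h1 : Db ≤ 3 * Dt + 3 * Dg + 3 * R) (h2 : Dt ≤ CT * ct) (h3 : ct ≤ 3 * cb + 3 * cr + 3 * cg) (h4 : cg ≤ εg * Dg) (h5 : cr ≤ 16 * dd * R)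
    (h6 : Dg ≤ A * Gg) (h7 : Gg ≤ 2 * G + 2 * Gr) (h8 : Gr ≤ κ * R) (h9 : R ≤ CL * Qn) :
    Db ≤ (9 * CT * nn + 2 * A * (9 * CT * εg + 3)) * (cb / nn + G) + ((2 * A * κ * (9 * CT * εg + 3) + 144 * dd * CT + 3) * CL) * Qn := by
  have hq : cb = nn * (cb / nn) := by field_simp
  have hq0 : 0 ≤ cb / nn := div_nonneg hcb hnn.le
  rw [hq] at h3
  have h23 : CT * ct ≤ CT * (3 * (nn * (cb / nn)) + 3 * cr + 3 * cg) := mul_le_mul_of_nonneg_left h3 hCT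
  have h4' : 3 * CT * cg ≤ 3 * CT * (εg * Dg) := mul_le_mul_of_nonneg_left h4 (by positivity)
  have h5' : 3 * CT * cr ≤ 3 * CT * (16 * dd * R) := mul_le_mul_of_nonneg_left h5 (by positivity)
  have h6' : (9 * CT * εg + 3) * Dg ≤ (9 * CT * εg + 3) * (A * Gg) := mul_le_mul_of_nonneg_left h6 (by positivity)
  have h7' : (9 * CT * εg + 3) * A * Gg ≤ (9 * CT * εg + 3) * A * (2 * G + 2 * Gr) := mul_le_mul_of_nonneg_left h7 (by positivity)
  have h8' : (9 * CT * εg + 3) * A * 2 * Gr ≤ (9 * CT * εg + 3) * A * 2 * (κ * R) := mul_le_mul_of_nonneg_left h8 (by positivity)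
  have h9' : (2 * A * κ * (9 * CT * εg + 3) + 144 * dd * CT + 3) * R ≤ (2 * A * κ * (9 * CT * εg + 3) + 144 * dd * CT + 3) * (CL * Qn) :=
    mul_le_mul_of_nonneg_left h9 (by positivity)
  have hextra : 0 ≤ 2 * A * (9 * CT * εg + 3) * (cb / nn) + 9 * CT * nn * G := by positivity
  nlinarith [h1, h2, h23, h4', h5', h6', h7', h8', h9', hextra]

set_option maxHeartbeats 400000 in
include hL2 hWP hθ hθl hd in
/-- **(CP_W) FROM ITS PIECES.**  Hypotheses: plaquette radius `η` of the background and row NE3's Poincaré regime `hsmall`; (H1) slice Poincaré on `T_A` with constant `C_T ≥ 0`;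
(H2) the Landau correction inside `N(Q′(W))`; (H4) `⟪R D† v, R D† v⟫ ≤ κ·dirSq (extF v)` with `κ ≥ 0`.  Conclusion: for every skew torus 1-form `b` (`P = N·L^{j+1}`, `M = L^{j+1}`),
`dirSq (extF b) ≤ C₁·(curlSq W (extF b)∕n + ⟪R D† b, R D† b⟫) + C₂·⟪Q̄ b, Q̄ b⟫` with `C₁ = 9·C_T·n + 2A(9C_Tε_g + 3)`, `C₂ = (2Aκ(9C_Tε_g + 3) + 144d·C_T + 3)·C_L`,
`A = 4nM²`, `ε_g = 16·n·#Plane·η²M²`, `C_L = n·(liftC∕(1−θ_loc M²x))²·M^{d−2}` — exactly the hypothesis `hCP` of F212's `softSymOpKa_posDef_of_constrainedPoincare`. [folklore] -/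
theorem constrainedPoincare_of_pieces {η : ℝ} (hWη : SmallField W η)
    (hsmall : 8 * d * (((L : ℝ) ^ (j + 1)) * (((d : ℝ) - 1) * (((L : ℝ) ^ (j + 1)) - 1) * x)) ^ 2
      + 2 * (Fintype.card n * (4 * (d : ℝ) ^ 2 * ((L : ℝ) ^ (j + 1) - 1) ^ 2 * x + 16 * d * loopRad d L ((prop1Radius d L)^[j] x)) ^ 2) ≤ 1 / 2)
    {CT : ℝ} (hCT : 0 ≤ CT)
    (H1 : ∀ t : skewForms d n (N * L ^ (j + 1)), qbarOpK (N := N) hL j hWu hx hs hWx t = 0 →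
      landauProjK L N (j + 1) W
          ((LinearMap.adjoint (𝕜 := ℝ) (E := skewSecs d n (N * L ^ (j + 1))) (F := skewForms d n (N * L ^ (j + 1))) (gradOpK hWu (N * L ^ (j + 1)))
            : skewForms d n (N * L ^ (j + 1)) →ₗ[ℝ] skewSecs d n (N * L ^ (j + 1))) t) = 0 →
      dirSq (extF (N * L ^ (j + 1)) (t : Form d n (N * L ^ (j + 1)))) (periodBox (d := d) (N * L ^ (j + 1)))
        ≤ CT * curlSq W (extF (N * L ^ (j + 1)) (t : Form d n (N * L ^ (j + 1)))) (periodBox (d := d) (N * L ^ (j + 1))))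
    (H2 : ∀ b' : skewForms d n (N * L ^ (j + 1)), qbarOpK (N := N) hL j hWu hx hs hWx b' = 0 →
      ∃ μ : Site d → Matrix n n ℂ, ∃ hμ : μ ∈ avgKernelGauges (d := d) (n := n) L N (j + 1) W,
        landauProjK L N (j + 1) W
          ((LinearMap.adjoint (𝕜 := ℝ) (E := skewSecs d n (N * L ^ (j + 1))) (F := skewForms d n (N * L ^ (j + 1))) (gradOpK hWu (N * L ^ (j + 1)))
            : skewForms d n (N * L ^ (j + 1)) →ₗ[ℝ] skewSecs d n (N * L ^ (j + 1)))
            (b' - gradOpK hWu (N * L ^ (j + 1)) ⟨resS (N * L ^ (j + 1)) μ, resS_mem_of_avgKernel hμ⟩)) = 0 ∧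
        qbarOpK (N := N) hL j hWu hx hs hWx (gradOpK hWu (N * L ^ (j + 1)) ⟨resS (N * L ^ (j + 1)) μ, resS_mem_of_avgKernel hμ⟩) = 0)
    {κ : ℝ} (hκ : 0 ≤ κ)
    (H4 : ∀ v : skewForms d n (N * L ^ (j + 1)),
      ⟪landauProjK L N (j + 1) W
          ((LinearMap.adjoint (𝕜 := ℝ) (E := skewSecs d n (N * L ^ (j + 1))) (F := skewForms d n (N * L ^ (j + 1))) (gradOpK hWu (N * L ^ (j + 1)))
            : skewForms d n (N * L ^ (j + 1)) →ₗ[ℝ] skewSecs d n (N * L ^ (j + 1))) v),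
        landauProjK L N (j + 1) W
          ((LinearMap.adjoint (𝕜 := ℝ) (E := skewSecs d n (N * L ^ (j + 1))) (F := skewForms d n (N * L ^ (j + 1))) (gradOpK hWu (N * L ^ (j + 1)))
            : skewForms d n (N * L ^ (j + 1)) →ₗ[ℝ] skewSecs d n (N * L ^ (j + 1))) v)⟫_ℝ
        ≤ κ * dirSq (extF (N * L ^ (j + 1)) (v : Form d n (N * L ^ (j + 1)))) (periodBox (d := d) (N * L ^ (j + 1))))
    (b : skewForms d n (N * L ^ (j + 1))) :
    dirSq (extF (N * L ^ (j + 1)) (b : Form d n (N * L ^ (j + 1)))) (periodBox (d := d) (N * L ^ (j + 1)))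
      ≤ (9 * CT * (Fintype.card n : ℝ)
            + 2 * (4 * Fintype.card n * ((L : ℝ) ^ (j + 1)) ^ 2)
              * (9 * CT * (16 * Fintype.card n * (Fintype.card (T4AveragingDeficitWall.Plane d)) * η ^ 2 * ((L : ℝ) ^ (j + 1)) ^ 2) + 3))
          * (curlSq W (extF (N * L ^ (j + 1)) (b : Form d n (N * L ^ (j + 1)))) (periodBox (d := d) (N * L ^ (j + 1))) / (Fintype.card n : ℝ)
              + ⟪landauProjK L N (j + 1) W
                  ((LinearMap.adjoint (𝕜 := ℝ) (E := skewSecs d n (N * L ^ (j + 1))) (F := skewForms d n (N * L ^ (j + 1))) (gradOpK hWu (N * L ^ (j + 1)))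
                    : skewForms d n (N * L ^ (j + 1)) →ₗ[ℝ] skewSecs d n (N * L ^ (j + 1))) b),
                 landauProjK L N (j + 1) W
                  ((LinearMap.adjoint (𝕜 := ℝ) (E := skewSecs d n (N * L ^ (j + 1))) (F := skewForms d n (N * L ^ (j + 1))) (gradOpK hWu (N * L ^ (j + 1)))
                    : skewForms d n (N * L ^ (j + 1)) →ₗ[ℝ] skewSecs d n (N * L ^ (j + 1))) b)⟫_ℝ)
        + ((2 * (4 * Fintype.card n * ((L : ℝ) ^ (j + 1)) ^ 2) * κ
              * (9 * CT * (16 * Fintype.card n * (Fintype.card (T4AveragingDeficitWall.Plane d)) * η ^ 2 * ((L : ℝ) ^ (j + 1)) ^ 2) + 3)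
              + 144 * (d : ℝ) * CT + 3)
            * (Fintype.card n * ((liftC d / (1 - thetaLoc d L * (((L : ℝ) ^ (j + 1)) ^ 2 * x))) ^ 2 * (((L : ℝ) ^ (j + 1)) ^ d / ((L : ℝ) ^ (j + 1)) ^ 2))))
          * ⟪qbarOpK (N := N) hL j hWu hx hs hWx b, qbarOpK (N := N) hL j hWu hx hs hWx b⟫_ℝ := by
  have hP : 1 ≤ N * L ^ (j + 1) := Nat.one_le_iff_ne_zero.mpr (NeZero.ne _)
  -- the lift `r` of `Q̄ b`
  obtain ⟨r, hr, hR⟩ := exists_lift_dirSq_le (N := N) hL hL2 j hWu hWP hx hs hWx hθ hθl hd (qbarOpK (N := N) hL j hWu hx hs hWx b)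
  -- the Landau correction of `b − r ∈ ker Q̄`
  have hQbr : qbarOpK (N := N) hL j hWu hx hs hWx (b - r) = 0 := by
    rw [map_sub (qbarOpK (N := N) hL j hWu hx hs hWx) b r, hr, sub_self]
  obtain ⟨μ, hμ, hRt0, hQg⟩ := H2 (b - r) hQbr
  -- `R D†(D_Wμ) = R D† b − R D† r`
  have hRg : landauProjK L N (j + 1) W
        ((LinearMap.adjoint (𝕜 := ℝ) (E := skewSecs d n (N * L ^ (j + 1))) (F := skewForms d n (N * L ^ (j + 1))) (gradOpK hWu (N * L ^ (j + 1)))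
          : skewForms d n (N * L ^ (j + 1)) →ₗ[ℝ] skewSecs d n (N * L ^ (j + 1)))
          (gradOpK hWu (N * L ^ (j + 1)) ⟨resS (N * L ^ (j + 1)) μ, resS_mem_of_avgKernel hμ⟩))
      = landauProjK L N (j + 1) W
          ((LinearMap.adjoint (𝕜 := ℝ) (E := skewSecs d n (N * L ^ (j + 1))) (F := skewForms d n (N * L ^ (j + 1))) (gradOpK hWu (N * L ^ (j + 1)))
            : skewForms d n (N * L ^ (j + 1)) →ₗ[ℝ] skewSecs d n (N * L ^ (j + 1))) b)
        - landauProjK L N (j + 1) W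
          ((LinearMap.adjoint (𝕜 := ℝ) (E := skewSecs d n (N * L ^ (j + 1))) (F := skewForms d n (N * L ^ (j + 1))) (gradOpK hWu (N * L ^ (j + 1)))
            : skewForms d n (N * L ^ (j + 1)) →ₗ[ℝ] skewSecs d n (N * L ^ (j + 1))) r) := by
    have h := hRt0
    rw [landauDiv_sub (N := N) j hWu (b - r) _, landauDiv_sub (N := N) j hWu b r, sub_eq_zero] at h
    exact h.symm
  -- the slice remainder `t`
  obtain ⟨t, ht⟩ : ∃ t : skewForms d n (N * L ^ (j + 1)), t = b - r - gradOpK hWu (N * L ^ (j + 1)) ⟨resS (N * L ^ (j + 1)) μ, resS_mem_of_avgKernel hμ⟩ :=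
    ⟨_, rfl⟩
  have hRt : landauProjK L N (j + 1) W
        ((LinearMap.adjoint (𝕜 := ℝ) (E := skewSecs d n (N * L ^ (j + 1))) (F := skewForms d n (N * L ^ (j + 1))) (gradOpK hWu (N * L ^ (j + 1)))
          : skewForms d n (N * L ^ (j + 1)) →ₗ[ℝ] skewSecs d n (N * L ^ (j + 1))) t) = 0 := by
    rw [ht]; exact hRt0
  have hQt : qbarOpK (N := N) hL j hWu hx hs hWx t = 0 := by
    rw [ht, map_sub (qbarOpK (N := N) hL j hWu hx hs hWx) (b - r) _, hQbr, hQg, sub_self]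
  have hbt : b = t + gradOpK hWu (N * L ^ (j + 1)) ⟨resS (N * L ^ (j + 1)) μ, resS_mem_of_avgKernel hμ⟩ + r := by rw [ht]; abel
  -- the nine real inequalities
  have h1 := dirSq_le_of_eq_add3 t (gradOpK hWu (N * L ^ (j + 1)) ⟨resS (N * L ^ (j + 1)) μ, resS_mem_of_avgKernel hμ⟩) r b hbt (periodBox (d := d) (N * L ^ (j + 1)))
  have h2 := H1 t hQt hRt
  have h3 := curlSq_le_of_eq_sub3 W b r (gradOpK hWu (N * L ^ (j + 1)) ⟨resS (N * L ^ (j + 1)) μ, resS_mem_of_avgKernel hμ⟩) t ht (periodBox (d := d) (N * L ^ (j + 1)))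
  have h4 := curlSq_pureGauge_le (N := N) hL2 j hWu hWP hx hs hWx hWη hsmall hμ
  have h5 := curlSq_le_dirSq hP hWu (isPeriodicDir_extF (N * L ^ (j + 1)) (r : Form d n (N * L ^ (j + 1))))
  have h6 := constrainedPoincare_pureGauge (N := N) hL2 j hWu hWP hx hs hWx hsmall hμ
  have h7 := inner_self_le_of_eq_sub _ _ _ hRg
  have h8 := H4 r
  exact core_assembly hCT (by positivity) hκ (by positivity) (Nat.cast_nonneg d) (Nat.cast_pos.mpr Fintype.card_pos)
    (curlSq_nonneg _ _ _) real_inner_self_nonneg h1 h2 h3 h4 h5 h6 h7 h8 hR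

end Carrier

end

end Summit.QuantumFields.BalabanUV.T4Continuum.NE7ConstrainedPoincareAssembly
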